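import Literature.NumberTheory.Transcendental.NesterenkoEliminationK
import Literature.NumberTheory.Transcendental.NesterenkoEliminationChowForm
import Mathlib.Algebra.MvPolynomial.Nilpotent
import HarnessLib

/-!
# Multihomogeneity of the associated form `F` of `Ī(r)` over an ARBITRARY field of characteristic zero (LNM 1752 Ch. 3 §4, remark after Prop. 4.4)

`Literature/NumberTheory/Transcendental/NesterenkoEliminationChowFormK.lean`. GENERIC-FIELD PORT of
the algebraic half of the tree's `NesterenkoEliminationChowForm.lean` (hard-wired to `ℚ[x̲]`), for
the generic objects `NesterenkoK.{elimIdeal, extIdeal, linForm, chowForm, ideg}`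
(`NesterenkoElimIdealPrime.lean`, `NesterenkoEliminationK.lean`); the exponent bookkeeping `bdeg`
of the `ℚ` file is field-free and is reused (`Nesterenko.bdeg`). Same text with `ℚ ↦ K`; the
rescaling argument (`uᵢ ↦ 2uᵢ`: `2ᵃ = 2ᵇ ⇒ a = b`) needs CHARACTERISTIC ZERO, assumed on the three
statements that use it. Chapter 10 of the book runs Ch. 3 §4 over `K = ℂ(z)` (p. 153); Prop. 4.7
(1) over `K` (degrees of the factorisation of Prop. 4.4) consumes this file.

* `map_mem_elimIdeal`: `Ī(r)` is stable under every algebra endomorphism of `K[U]` that extends to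
  `K[U, x̲]` fixing the `xⱼ` and mapping each `Lᵢ` into `(L₁, …, L_r)`; in particular under
  rescaling one block of variables `uᵢ ↦ c uᵢ` (`scaleU`) and under permuting the blocks
  (`swapU K`). Hence a generator `F` of `Ī(r)` is an eigenvector of these maps
  (`exists_eq_C_mul_chowForm`), so `F` is multihomogeneous with all block degrees equal to
  `deg I = deg_{u₁} F` (`bdeg_eq_ideg_of_mem_support_chowForm`), and every monomial of `F` has
  total degree `r · deg I` (`degree_eq_of_mem_support_chowForm`) — the remark after
  Proposition 4.4 (p. 38).

The complex-analytic half of the `ℚ` file (`kappa_smul_chowForm_eq_zero`, Cor. 4.10) is specific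
to `K = ℚ ⊂ ℂ` and is not ported. Principality of `Ī(r)` (Proposition 4.4) is NOT used: when
`Ī(r)` is not principal `chowForm` is the junk value `0` and everything is vacuous.

## References

* [NesterenkoPhilippon2001] Yu. V. Nesterenko, P. Philippon (eds.), *Introduction to Algebraic
  Independence Theory*, LNM 1752, Springer 2001, Ch. 3 §4, Def. 4.3–4.6, Prop. 4.4 and the remark
  after it (p. 38), Cor. 4.10 (p. 40).
-/

noncomputable section

open MvPolynomial

namespace Literature.NumberTheory.Transcendental

namespace NesterenkoK

variable {K : Type*} [Field K] {m : ℕ}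

/-! ### Stability of `Ī(r)` under compatible endomorphisms -/

/-- If an algebra endomorphism `φ` of `K[U]` extends to an endomorphism `Φ` of `K[U, x̲]` that
fixes the `xⱼ` and maps every `Lᵢ` into the ideal `(L₁, …, L_r)`, then `φ(Ī(r)) ⊆ Ī(r)`.
[folklore] -/
theorem map_mem_elimIdeal (I : Ideal (MvPolynomial (Fin (m + 1)) K)) (r : ℕ) (φ : (MvPolynomial (Fin r × Fin (m + 1)) K) →ₐ[K] (MvPolynomial (Fin r × Fin (m + 1)) K))
    (Φ : (MvPolynomial ((Fin r × Fin (m + 1)) ⊕ Fin (m + 1)) K) →ₐ[K] (MvPolynomial ((Fin r × Fin (m + 1)) ⊕ Fin (m + 1)) K))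
    (hU : ∀ v : Fin r × Fin (m + 1), Φ (X (Sum.inl v)) = rename Sum.inl (φ (X v)))
    (hx : ∀ j : Fin (m + 1), Φ (X (Sum.inr j)) = X (Sum.inr j))
    (hL : ∀ i : Fin r, Φ (linForm K r m i) ∈ Ideal.span (Set.range (linForm K r m)))
    {G : (MvPolynomial (Fin r × Fin (m + 1)) K)} (hG : G ∈ elimIdeal I r) : φ G ∈ elimIdeal I r := by
  have h1 : Φ.comp (rename Sum.inl) = (rename Sum.inl).comp φ := by
    apply MvPolynomial.algHom_ext
    intro v
    simp [hU]
  have h2 : Φ.comp (rename Sum.inr) = (rename Sum.inr : (MvPolynomial (Fin (m + 1)) K) →ₐ[K] (MvPolynomial ((Fin r × Fin (m + 1)) ⊕ Fin (m + 1)) K)) := by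
    apply MvPolynomial.algHom_ext
    intro j
    simp [hx]
  have hA : Ideal.map (rename Sum.inr) I ≤ (extIdeal I r).comap Φ := by
    rw [Ideal.map_le_iff_le_comap]
    intro P hP
    rw [Ideal.mem_comap, Ideal.mem_comap,
      show Φ (rename Sum.inr P) = rename Sum.inr P from AlgHom.congr_fun h2 P]
    exact Ideal.mem_sup_left (Ideal.mem_map_of_mem _ hP)
  have hB : Ideal.span (Set.range (linForm K r m)) ≤ (extIdeal I r).comap Φ := by
    rw [Ideal.span_le]
    rintro _ ⟨i, rfl⟩
    rw [SetLike.mem_coe, Ideal.mem_comap]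
    exact Ideal.mem_sup_right (hL i)
  have hext : extIdeal I r ≤ (extIdeal I r).comap Φ := sup_le hA hB
  obtain ⟨M, hM, hGM⟩ := hG
  refine ⟨M, hM, fun j => ?_⟩
  have h := hext (hGM j)
  rw [Ideal.mem_comap, map_mul, map_pow, hx j,
    show Φ (rename Sum.inl G) = rename Sum.inl (φ G) from AlgHom.congr_fun h1 G] at h
  exact h

/-- A generator `F` of `Ī(r)` is an eigenvector of every invertible endomorphism preserving `Ī(r)`:
`φ F = c F` with `c ∈ Kˣ`. [folklore] -/
theorem exists_eq_C_mul_chowForm (I : Ideal (MvPolynomial (Fin (m + 1)) K)) (r : ℕ) (φ ψ : (MvPolynomial (Fin r × Fin (m + 1)) K) →ₐ[K] (MvPolynomial (Fin r × Fin (m + 1)) K))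
    (hφ : ∀ G ∈ elimIdeal I r, φ G ∈ elimIdeal I r)
    (hψ : ∀ G ∈ elimIdeal I r, ψ G ∈ elimIdeal I r)
    (hinv : ∀ G, φ (ψ G) = G) (hpr : (elimIdeal I r).IsPrincipal) :
    ∃ c : K, c ≠ 0 ∧ φ (chowForm I r) = C c * chowForm I r := by
  set F := chowForm I r
  have hspan : Ideal.span {F} = elimIdeal I r := span_chowForm I r hpr
  have hmap : Ideal.map φ (elimIdeal I r) = elimIdeal I r := by
    apply le_antisymm
    · rw [Ideal.map_le_iff_le_comap]
      intro G hG
      exact hφ G hG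
    · intro G hG
      rw [← hinv G]
      exact Ideal.mem_map_of_mem φ (hψ G hG)
  have hspan' : Ideal.span {φ F} = Ideal.span {F} := by
    rw [hspan, ← hmap, ← hspan, Ideal.map_span, Set.image_singleton]
  obtain ⟨u, hu⟩ := Ideal.span_singleton_eq_span_singleton.mp hspan'
  obtain ⟨c, hc, hcu⟩ := MvPolynomial.isUnit_iff_eq_C_of_isReduced.mp u.isUnit
  have hc0 : c ≠ 0 := hc.ne_zero
  refine ⟨c⁻¹, inv_ne_zero hc0, ?_⟩
  have hF : φ F * C c = F := by rw [← hcu]; exact hu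
  calc φ F = φ F * C c * C c⁻¹ := by
        rw [mul_assoc, ← C_mul, mul_inv_cancel₀ hc0, C_1, mul_one]
    _ = C c⁻¹ * F := by rw [hF, mul_comm]

/-! ### Rescaling one block of variables -/

/-- The endomorphism `u_{ij} ↦ c u_{ij}` (for the block `i` only) of `K[U]`. [folklore] -/
def scaleU (r m : ℕ) (i : Fin r) (c : K) : (MvPolynomial (Fin r × Fin (m + 1)) K) →ₐ[K] (MvPolynomial (Fin r × Fin (m + 1)) K) :=
  aeval fun v : Fin r × Fin (m + 1) => if v.1 = i then C c * X v else X v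

/-- Its extension to `K[U, x̲]` fixing the `xⱼ`. [folklore] -/
def scaleUX (r m : ℕ) (i : Fin r) (c : K) : (MvPolynomial ((Fin r × Fin (m + 1)) ⊕ Fin (m + 1)) K) →ₐ[K] (MvPolynomial ((Fin r × Fin (m + 1)) ⊕ Fin (m + 1)) K) :=
  aeval (Sum.elim (fun v : Fin r × Fin (m + 1) =>
    if v.1 = i then C c * X (Sum.inl v) else X (Sum.inl v)) fun j => X (Sum.inr j))

/-- `Ī(r)` is stable under rescaling a block of variables. [folklore] -/
theorem scaleU_mem_elimIdeal (I : Ideal (MvPolynomial (Fin (m + 1)) K)) (r : ℕ) (i : Fin r) (c : K) {G : (MvPolynomial (Fin r × Fin (m + 1)) K)}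
    (hG : G ∈ elimIdeal I r) : scaleU r m i c G ∈ elimIdeal I r := by
  refine map_mem_elimIdeal I r (scaleU r m i c) (scaleUX r m i c) (fun v => ?_) (fun j => ?_)
    (fun i' => ?_) hG
  · simp only [scaleU, scaleUX, aeval_X, Sum.elim_inl]
    split_ifs <;> simp
  · simp [scaleUX]
  · by_cases h : i' = i
    · subst h
      have e : scaleUX r m i' c (linForm K r m i') = C c * linForm K r m i' := by
        simp only [linForm, map_sum, map_mul, scaleUX, aeval_X, Sum.elim_inl, Sum.elim_inr,
          Finset.mul_sum]
        refine Finset.sum_congr rfl fun j _ => ?_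
        rw [if_pos trivial]
        ring
      rw [e]
      exact Ideal.mul_mem_left _ _ (Ideal.subset_span ⟨i', rfl⟩)
    · have e : scaleUX r m i c (linForm K r m i') = linForm K r m i' := by
        simp only [linForm, map_sum, map_mul, scaleUX, aeval_X, Sum.elim_inl, Sum.elim_inr,
          if_neg h]
      rw [e]
      exact Ideal.subset_span ⟨i', rfl⟩

/-- Rescaling by `c` and then by `c⁻¹` is the identity. [folklore] -/
theorem scaleU_scaleU_inv (r m : ℕ) (i : Fin r) {c : K} (hc : c ≠ 0) (G : (MvPolynomial (Fin r × Fin (m + 1)) K)) :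
    scaleU r m i c (scaleU r m i c⁻¹ G) = G := by
  have h : (scaleU r m i c).comp (scaleU r m i c⁻¹) = AlgHom.id K ((MvPolynomial (Fin r × Fin (m + 1)) K)) := by
    apply MvPolynomial.algHom_ext
    intro v
    simp only [AlgHom.comp_apply, scaleU, aeval_X, AlgHom.id_apply]
    split_ifs with hv
    · rw [map_mul, algHom_C, MvPolynomial.algebraMap_eq, aeval_X, if_pos hv, ← mul_assoc,
        ← C_mul, inv_mul_cancel₀ hc, C_1, one_mul]
    · rw [aeval_X, if_neg hv]
  exact AlgHom.congr_fun h G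

/-- `scaleU` acts diagonally on monomials: `U^γ ↦ c^{deg_{uᵢ} γ} U^γ`. [folklore] -/
theorem scaleU_monomial (r m : ℕ) (i : Fin r) (c : K) (γ : Fin r × Fin (m + 1) →₀ ℕ) (a : K) :
    scaleU r m i c (monomial γ a) = monomial γ (c ^ Nesterenko.bdeg i γ * a) := by
  have hprod : (γ.prod fun v e => (if v.1 = i then C c * X v else X v : (MvPolynomial (Fin r × Fin (m + 1)) K)) ^ e) =
      C (c ^ Nesterenko.bdeg i γ) * γ.prod fun v e => (X v : (MvPolynomial (Fin r × Fin (m + 1)) K)) ^ e := by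
    have h1 : ∀ (v : Fin r × Fin (m + 1)) (e : ℕ),
        (if v.1 = i then C c * X v else X v : (MvPolynomial (Fin r × Fin (m + 1)) K)) ^ e =
          C ((if v.1 = i then c else 1) ^ e) * X v ^ e := by
      intro v e
      split_ifs <;> simp [mul_pow]
    simp_rw [h1]
    rw [Finsupp.prod_mul]
    congr 1
    rw [Finsupp.prod_fintype _ _ (fun v => by simp), ← map_prod C]
    congr 1
    rw [Fintype.prod_prod_type, Finset.prod_eq_single i (fun i' _ hi' => by simp [hi'])
      (fun h => absurd (Finset.mem_univ i) h)]
    simp [Nesterenko.bdeg, Finset.prod_pow_eq_pow_sum]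
  simp only [scaleU, aeval_monomial, MvPolynomial.algebraMap_eq]
  rw [hprod, ← mul_assoc, ← C_mul, mul_comm a, monomial_eq]

/-- Coefficientwise: `coeff γ (scaleU F) = c^{deg_{uᵢ} γ} · coeff γ F`. [folklore] -/
theorem coeff_scaleU (r m : ℕ) (i : Fin r) (c : K) (F : (MvPolynomial (Fin r × Fin (m + 1)) K)) (γ : Fin r × Fin (m + 1) →₀ ℕ) :
    coeff γ (scaleU r m i c F) = c ^ Nesterenko.bdeg i γ * coeff γ F := by
  classical
  conv_lhs => rw [F.as_sum, map_sum]
  simp only [scaleU_monomial, coeff_sum, coeff_monomial]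
  rw [Finset.sum_ite_eq']
  split_ifs with h
  · rfl
  · rw [MvPolynomial.notMem_support_iff.mp h, mul_zero]

/-- All monomials of the associated form have the same degree in each block `uᵢ`
(multihomogeneity). [cite: NesterenkoPhilippon2001, Ch. 3, remark after Prop. 4.4 (p. 38)] -/
theorem bdeg_eq_bdeg_of_mem_support_chowForm [CharZero K] (I : Ideal (MvPolynomial (Fin (m + 1)) K)) (r : ℕ) (i : Fin r)
    {γ γ' : Fin r × Fin (m + 1) →₀ ℕ} (hγ : γ ∈ (chowForm I r).support)
    (hγ' : γ' ∈ (chowForm I r).support) : Nesterenko.bdeg i γ = Nesterenko.bdeg i γ' := by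
  by_cases hpr : (elimIdeal I r).IsPrincipal
  swap
  · simp [chowForm, hpr] at hγ
  obtain ⟨c, -, hcF⟩ := exists_eq_C_mul_chowForm I r (scaleU r m i 2) (scaleU r m i 2⁻¹)
    (fun G hG => scaleU_mem_elimIdeal I r i 2 hG) (fun G hG => scaleU_mem_elimIdeal I r i 2⁻¹ hG)
    (scaleU_scaleU_inv r m i (two_ne_zero : (2 : K) ≠ 0)) hpr
  have key : ∀ δ ∈ (chowForm I r).support, (2 : K) ^ Nesterenko.bdeg i δ = c := by
    intro δ hδ
    have h := congrArg (coeff δ) hcF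
    rw [coeff_scaleU, coeff_C_mul] at h
    exact mul_right_cancel₀ (mem_support_iff.mp hδ) h
  have h2 := (key γ hγ).trans (key γ' hγ').symm
  -- `2 ^ a = 2 ^ b` in a field of characteristic zero forces `a = b`
  have h2' : ((2 ^ Nesterenko.bdeg i γ : ℕ) : K) = ((2 ^ Nesterenko.bdeg i γ' : ℕ) : K) := by
    push_cast; exact h2
  exact Nat.pow_right_injective le_rfl (Nat.cast_injective h2')

/-! ### Permuting the blocks of variables -/

variable (K) in
/-- The automorphism `u_{ij} ↦ u_{σ(i) j}` of `K[U]`. [folklore] -/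
def swapU (r m : ℕ) (σ : Equiv.Perm (Fin r)) : (MvPolynomial (Fin r × Fin (m + 1)) K) →ₐ[K] (MvPolynomial (Fin r × Fin (m + 1)) K) :=
  rename (Prod.map σ id)

variable (K) in
/-- Its extension to `K[U, x̲]` fixing the `xⱼ`. [folklore] -/
def swapUX (r m : ℕ) (σ : Equiv.Perm (Fin r)) : (MvPolynomial ((Fin r × Fin (m + 1)) ⊕ Fin (m + 1)) K) →ₐ[K] (MvPolynomial ((Fin r × Fin (m + 1)) ⊕ Fin (m + 1)) K) :=
  rename (Sum.map (Prod.map σ id) id)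

/-- `Ī(r)` is stable under permuting the blocks (it permutes the `Lᵢ`). [folklore] -/
theorem swapU_mem_elimIdeal (I : Ideal (MvPolynomial (Fin (m + 1)) K)) (r : ℕ) (σ : Equiv.Perm (Fin r)) {G : (MvPolynomial (Fin r × Fin (m + 1)) K)}
    (hG : G ∈ elimIdeal I r) : swapU K r m σ G ∈ elimIdeal I r := by
  refine map_mem_elimIdeal I r (swapU K r m σ) (swapUX K r m σ) (fun v => ?_) (fun j => ?_)
    (fun i' => ?_) hG
  · simp [swapU, swapUX]
  · simp [swapUX]
  · have e : swapUX K r m σ (linForm K r m i') = linForm K r m (σ i') := by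
      simp [swapUX, linForm, map_sum]
    rw [e]
    exact Ideal.subset_span ⟨σ i', rfl⟩

/-- `swapU K σ ∘ swapU K σ⁻¹ = id`. [folklore] -/
theorem swapU_swapU_symm (r m : ℕ) (σ : Equiv.Perm (Fin r)) (G : (MvPolynomial (Fin r × Fin (m + 1)) K)) :
    swapU K r m σ (swapU K r m σ.symm G) = G := by
  rw [swapU, swapU, rename_rename]
  have : (Prod.map σ id ∘ Prod.map σ.symm id : Fin r × Fin (m + 1) → Fin r × Fin (m + 1)) = id := by
    funext ⟨a, b⟩
    simp
  rw [this, rename_id]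
  rfl

/-- The support of the associated form is stable under permuting the blocks (symmetry of `F` in
`u₁, …, u_r`). [cite: NesterenkoPhilippon2001, Ch. 3, remark after Prop. 4.4 (p. 38)] -/
theorem mapDomain_mem_support_chowForm (I : Ideal (MvPolynomial (Fin (m + 1)) K)) (r : ℕ) (σ : Equiv.Perm (Fin r))
    {γ : Fin r × Fin (m + 1) →₀ ℕ} (hγ : γ ∈ (chowForm I r).support) :
    Finsupp.mapDomain (Prod.map σ id) γ ∈ (chowForm I r).support := by
  by_cases hpr : (elimIdeal I r).IsPrincipal
  swap
  · simp [chowForm, hpr] at hγ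
  obtain ⟨c, -, hcF⟩ := exists_eq_C_mul_chowForm I r (swapU K r m σ) (swapU K r m σ.symm)
    (fun G hG => swapU_mem_elimIdeal I r σ hG) (fun G hG => swapU_mem_elimIdeal I r σ.symm hG)
    (swapU_swapU_symm r m σ) hpr
  have hinj : Function.Injective (Prod.map σ id : Fin r × Fin (m + 1) → Fin r × Fin (m + 1)) :=
    (σ.prodCongr (Equiv.refl _)).injective
  have h := coeff_rename_mapDomain (Prod.map σ id) hinj (chowForm I r) γ
  change coeff (Finsupp.mapDomain (Prod.map σ id) γ) (swapU K r m σ (chowForm I r)) =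
    coeff γ (chowForm I r) at h
  rw [hcF, coeff_C_mul] at h
  rw [mem_support_iff] at hγ ⊢
  intro h0
  rw [h0, mul_zero] at h
  exact hγ h.symm

/-- All block degrees of all monomials of the associated form equal `deg I = deg_{u₁} F`.
[cite: NesterenkoPhilippon2001, Ch. 3, remark after Prop. 4.4 and Def. 4.5 (p. 38)] -/
theorem bdeg_eq_ideg_of_mem_support_chowForm [CharZero K] (I : Ideal (MvPolynomial (Fin (m + 1)) K)) {r : ℕ} (hr : 0 < r)
    {γ : Fin r × Fin (m + 1) →₀ ℕ} (hγ : γ ∈ (chowForm I r).support) (i : Fin r) :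
    Nesterenko.bdeg i γ = ideg I r := by
  set i₀ : Fin r := ⟨0, hr⟩
  have hideg : ideg I r = Nesterenko.bdeg i₀ γ := by
    rw [ideg, dif_pos hr]
    change (chowForm I r).support.sup (Nesterenko.bdeg i₀) = Nesterenko.bdeg i₀ γ
    apply le_antisymm
    · exact Finset.sup_le fun δ hδ => (bdeg_eq_bdeg_of_mem_support_chowForm I r i₀ hδ hγ).le
    · exact Finset.le_sup (f := Nesterenko.bdeg i₀) hγ
  set σ : Equiv.Perm (Fin r) := Equiv.swap i₀ i
  have hγ₁ := mapDomain_mem_support_chowForm I r σ hγ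
  have hinj : Function.Injective (Prod.map σ id : Fin r × Fin (m + 1) → Fin r × Fin (m + 1)) :=
    (σ.prodCongr (Equiv.refl _)).injective
  have hcomp : Nesterenko.bdeg i₀ (Finsupp.mapDomain (Prod.map σ id) γ) = Nesterenko.bdeg i γ := by
    unfold Nesterenko.bdeg
    refine Finset.sum_congr rfl fun j _ => ?_
    have e : ((i₀, j) : Fin r × Fin (m + 1)) = Prod.map σ id (i, j) := by
      simp [σ, Equiv.swap_apply_right]
    rw [e, Finsupp.mapDomain_apply hinj]
  rw [← hcomp, bdeg_eq_bdeg_of_mem_support_chowForm I r i₀ hγ₁ hγ, ← hideg]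

/-- Every monomial of the associated form `F` of index `r ≥ 1` has total degree `r · deg I`
(so `ϰ(F)` is homogeneous of degree `r deg I` in `ω̄`, which is what makes `|I(ω̄)|`
well-scaled). [cite: NesterenkoPhilippon2001, Ch. 3, remark after Prop. 4.4 and Def. 4.6 (p. 38–39)] -/
theorem degree_eq_of_mem_support_chowForm [CharZero K] (I : Ideal (MvPolynomial (Fin (m + 1)) K)) {r : ℕ} (hr : 0 < r)
    {γ : Fin r × Fin (m + 1) →₀ ℕ} (hγ : γ ∈ (chowForm I r).support) :
    γ.degree = r * ideg I r := by
  rw [Finsupp.degree_eq_sum, Fintype.sum_prod_type]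
  have h : ∀ i : Fin r, ∑ j : Fin (m + 1), γ (i, j) = ideg I r := fun i =>
    bdeg_eq_ideg_of_mem_support_chowForm I hr hγ i
  simp only [h, Finset.sum_const, Finset.card_univ, Fintype.card_fin, smul_eq_mul]

/-! ### `ϰ_β̄(F) = 0` for `β̄ ∈ V(I)` -/

end NesterenkoK

end Literature.NumberTheory.Transcendental

end
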